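import Literature.NumberTheory.Automorphic.RamifiedPlaceTraceDual          -- ★ p851014: `exists_different_traceDual_of_ramified` (trace image ∕ inverse different `𝔭_w^{−d}` at a RAMIFIED CM place), `exists_toPlace_eq_add_galAdicCompletionMap`; brings ★ `toPlace`, `galAdicCompletionMap`, the `Valued`–`ValuativeRel` bridge
import Literature.NumberTheory.LocalFields.UnramifiedQuadraticUnitTrace      -- ★ `UnramifiedQuadraticNorm.exists_v_eq_one_v_add_galAdicCompletionMap_eq_one` (a unit of unit trace at an INERT-unramified place)
import Literature.NumberTheory.Automorphic.AdeleAddCharLocalNontrivial        -- ★ `isContinuousNontrivial_adeleAddCharAt` (Tate Lemma 2.2.3): `ψ_w` continuous non-trivial on `L_w`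
import Literature.NumberTheory.Automorphic.AdditiveCharacterDuality          -- ★ `AddCharDuality.exists_mulShift_level_one` (Bump Ex. 3.1.1 (b)) on `L⁺_v`
import Mathlib.NumberTheory.RamificationInertia.Unramified
import HarnessLib

/-!
# Crux `H413` — K2-LIT E3 «EllipticInputs», U12-h brick (Psi-twisted): AT A NON-SPLIT PLACE `w ∣ v` OF THE CM EXTENSION `L ∕ L⁺`, A LOCAL ADDITIVE CHARACTER OF `L_w` OF
# CONDUCTOR EXACTLY `𝒪_w` WHICH KILLS THE `ε`-EIGENLINE OF `σ_w` (`ε = +1`: the fixed field `L⁺_v` — ramified places; `ε = −1`: the skew line — inert places) — the letters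
# `hψ` ∕ `hψ'` ∕ `hanti` of ★ p855984 `K2E3UnitaryLayerCharacters` (Char-U) and of the (N-U) ∕ (P-U) packages of the non-split 9L assembly

Cell `hodgecm-mathlib`, Track B «K2-LIT», crux item `stmt-HodgeConjecture-24833` (h413), line `K2_E3_EllipticInputs`, unit U12 «HC characters», socket U12-h
`sig_K2E3CharLocConstNearRegular` (‹#9L›), depth-halving road, NON-SPLIT half (`hStabNs` of ★ p856048); brick (2) «(Psi) twisted» dealt BY NAME by the 9L line lead K2E3-p09 (g2) to seat
K2E4-p02 (g2) (K2 bus 2026-09-04T00:17:30Z); `--supports stmt-HodgeConjecture-24833 --as helper`.  THEOREMS ONLY — no `def`, no named fact, no instance, no notation, no `sorry`.  HONEST LABEL: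
HC_CM is proved only modulo the 7 printed citations (2 remaining named inputs: hLiu418 = stmt-HodgeConjecture-24832, h413 = stmt-HodgeConjecture-24833) until rung 0 closes; count-neutral
plumbing (unconditional local algebra of the completions `L_w ∕ L⁺_v`).

THE STATEMENT (p09's bytes).  `E := w.1.adicCompletion L`, `σ := galAdicCompletionMap (L := L) (IsCMField.complexConj L) hw : E →+* E`, `ϖ` ANY uniformizing element of `E` (★ `IsUniformizingElement`):
`∃ (ε : E) (ψ : AddChar E Circle), (ε = 1 ∨ ε = −1) ∧ (∀ x, valuation E x ≤ 1 → ψ x = 1) ∧ (∃ x, valuation E x ≤ (valuation E ϖ)⁻¹ ∧ ψ x ≠ 1) ∧ (∀ a, σ a = ε * a → ψ a = 1)`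
(`exists_sign_addChar_conductor_integers_anti`), with the two halves `…_of_ramified` (`ε = 1`, `e(w|v) ≠ 1`) and `…_of_isUnramifiedIn` (`ε = −1`, `v` unramified in `L`), each also with
`Continuous ψ`.

THE MATHEMATICS [Serre1979, Ch. III §3 Prop. 7, §6 Cor. 2, Ch. V §2; WeilBNT1967, Ch. II §5 Prop. 12, Ch. VIII §1; BushnellHenniart2006, §1.7; CasselsFrohlichANT1967, Ch. XV (Tate) Lemma 2.2.3].
Write `ι := toPlace v w : L⁺_v →+* L_w`, `Tr_σ y := y + σ y ∈ ι(L⁺_v)` (★ `exists_toPlace_eq_add_galAdicCompletionMap`).  Every character of the shape `Ψ_c(x) := ψ₃(c·x + σ(c·x))` kills the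
`ε`-eigenline `{σ a = ε a}` as soon as `σ c = −ε c` (`c·a + σc·σa = c·a − ε²c·a = 0`); its values are the values of `ψ₃` on the fixed line `ι(L⁺_v)`.  STEP 1 (the base character):
starting from Tate's `ψ_w := adeleAddCharAt L w.1` (★ continuous, non-trivial at some `x₁`), `ψ₂ := ψ_w(x₁·)` restricts along `ι` to a CONTINUOUS NON-TRIVIAL character `ψ_F` of `L⁺_v` (`ψ_F 1 =
ψ_w x₁ ≠ 1`); by level normalisation on the local field `L⁺_v` (★ `exists_mulShift_level_one` + one shift by a uniformiser, as in ★ p855947) some `g ∈ L⁺_v` makes `f ↦ ψ_F(g f)` of conductor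
EXACTLY `𝒪_v` (trivial on `|f|_v ≤ 1`, `≠ 1` at some `z` with `|z|_v ≤ exp 1`) — `exists_mul_conductor_integers`; put `ψ₃ := ψ₂(ι g ·)`, so `ψ₃(ι f) = ψ_F(g f)`.  STEP 2R (RAMIFIED, `ε = +1`):
`c := (στ − τ)⁻¹` for a uniformiser `τ` is SKEW of valuation `exp d`, `d` the different exponent (★ `exists_different_traceDual_of_ramified`: `|στ − τ| = exp(−d)`; INVERSE DIFFERENT «`∀ |x| ≤ 1,
|xc + σ(xc)| ≤ 1 ⟺ |c| ≤ exp d`» ⇒ `Ψ_c` is trivial on `𝒪_w`; SHARP PREIMAGES «`∃ y, y + σy = ι z, |y|·exp(1 − d) = |ι z| = |z|_v²`» ⇒ `x := y(στ − τ)` has `|x| = |ι z|·exp(−1) ≤ exp 1 = |ϖ|⁻¹` and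
`Ψ_c(x) = ψ₃(ι z) ≠ 1`).  STEP 2U (INERT-UNRAMIFIED, `ε = −1`): `c := 1`; `|x + σx| ≤ |x|` (★ `σ` isometric) gives triviality on `𝒪_w`; with ★ `ω` (`|ω| = |ω + σω| = 1`, `ω + σω = ι t₀`)
the element `x := ι(z t₀⁻¹)·ω` has `x + σx = ι z` and `|x| = |ι z| = |z|_v ≤ exp 1` (`e(w|v) = 1`).  No discriminant-parity statement is needed: the «different number is the different» package
of ★ `RamifiedPlaceTraceDual` already carries the ramified case in any residue characteristic.

* §1 generic twists: `exists_addChar_twist` (`Ψ_c` as an `AddChar`, values, killing of the `ε`-line), `exists_mul_conductor_integers` (STEP 1 on any `K_v`), valuation bookkeeping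
  (`valuation_le_inv_of_v_le_exp_one`, `v_le_one_of_pow_le_one`);  §2 `exists_addChar_conductor_integers_anti_of_ramified` (`ε = 1`), `…_of_isUnramifiedIn` (`ε = −1`),
  `ramificationIdx'_ne_one_of_not_isUnramifiedIn` (the dichotomy), and the dealt bytes `exists_sign_addChar_conductor_integers_anti`.

## References
* [Serre1979] J.-P. Serre, *Local Fields*, GTM 67 (1979): Ch. III §3 Prop. 7 (`Tr 𝔭_L^m = 𝔭_K^{⌊(m+d)∕e⌋}`), §6 Cor. 2; Ch. V §2 (unramified trace is onto).
* [WeilBNT1967] A. Weil, *Basic Number Theory* (1967): Ch. II §5 Prop. 12 (characters of a local field, `a ↦ ψ(a·)`), Ch. VIII §1 (the different as the conductor of `ψ ∘ Tr`).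
* [BushnellHenniart2006] C. J. Bushnell, G. Henniart, *The Local Langlands Conjecture for GL(2)* (2006), §1.7 (level of `ψ`; rescaling).
* [CasselsFrohlichANT1967] J. Tate, *Fourier analysis in number fields and Hecke's zeta-functions*, Ch. XV of Cassels–Fröhlich (1967), Lemma 2.2.3 (`ψ_v` non-trivial).
-/

set_option autoImplicit false
-- the mandated namespace repeats `HodgeConjecture.HodgeConjecture`, as in every `Theorems/*.lean` of this sub-problem
set_option linter.dupNamespace false

noncomputable section

open NumberField IsDedekindDomain ValuativeRel
open Literature.NumberTheory.Automorphic Literature.NumberTheory.Automorphic.UnitaryGroup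
open scoped WithZero

namespace Summit.HodgeConjecture.HodgeConjecture.Cruxes.H413.K2E3LocalAdditiveCharacterTwisted

/-! ## §1 Generic: twisted characters, level normalisation in `Valued` currency, valuation bookkeeping -/

section Generic

variable {K : Type*} [Field K]

/-- **THE `σ`-TWIST `Ψ_c(x) = ψ(c·x + σ(c·x))` IS AN ADDITIVE CHARACTER**, and it KILLS THE `ε`-EIGENLINE of `σ` whenever `σ c = −ε c` and `ε² = 1`:
`c·a + σ(c)·σ(a) = c·a − ε²·c·a = 0`. [cite: WeilBNT1967, Ch. II §5 Prop. 12] -/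
theorem exists_addChar_twist (σ : K →+* K) (ψ : AddChar K Circle) (c : K) :
    ∃ Ψ : AddChar K Circle, (∀ x, Ψ x = ψ (c * x + σ (c * x))) ∧
      ∀ ε : K, ε * ε = 1 → σ c = -(ε * c) → ∀ a : K, σ a = ε * a → Ψ a = 1 := by
  refine ⟨ψ.compAddMonoidHom (AddMonoidHom.mulLeft c + σ.toAddMonoidHom.comp (AddMonoidHom.mulLeft c)), fun x => rfl, fun ε hε hc a ha => ?_⟩
  show ψ (c * a + σ (c * a)) = 1
  rw [map_mul, hc, ha, show c * a + -(ε * c) * (ε * a) = (1 - ε * ε) * (c * a) by ring, hε, sub_self, zero_mul, AddChar.map_zero_eq_one]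

/-- The twist is continuous when `ψ` and `σ` are (topological field). [folklore] -/
theorem continuous_twist [TopologicalSpace K] [IsTopologicalRing K] {σ : K →+* K} (hσ : Continuous σ) {ψ : AddChar K Circle} (hψ : Continuous ψ) (c : K)
    {Ψ : AddChar K Circle} (hΨ : ∀ x, Ψ x = ψ (c * x + σ (c * x))) : Continuous Ψ := by
  have h : (⇑Ψ : K → Circle) = fun x => ψ (c * x + σ (c * x)) := funext hΨ
  rw [h]
  exact hψ.comp ((continuous_const.mul continuous_id).add (hσ.comp (continuous_const.mul continuous_id)))

/-- A rescaled additive character `ψ(a·)` is continuous when `ψ` is. [folklore] -/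
theorem continuous_mulShift [TopologicalSpace K] [IsTopologicalRing K] {ψ : AddChar K Circle} (hψ : Continuous ψ) (a : K) : Continuous (ψ.mulShift a) := by
  have h : (⇑(ψ.mulShift a) : K → Circle) = fun x => ψ (a * x) := funext fun x => AddChar.mulShift_apply
  rw [h]
  exact hψ.comp (continuous_const.mul continuous_id)

variable [Valued K ℤᵐ⁰] [ValuativeRel K] [(Valued.v : Valuation K ℤᵐ⁰).Compatible]

/-- `Valued` ↔ `ValuativeRel` bookkeeping: for a uniformizing `ϖ` (so `|ϖ| < 1`, i.e. `|ϖ| ≤ exp(−1)`) and `|x| ≤ exp 1`: `valuation K x ≤ (valuation K ϖ)⁻¹`. [folklore] -/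
theorem valuation_le_inv_of_v_le_exp_one {ϖ : K} (hϖ : IsUniformizingElement ϖ) {x : K} (hx : Valued.v x ≤ WithZero.exp (1 : ℤ)) : valuation K x ≤ (valuation K ϖ)⁻¹ := by
  have hϖ0 : valuation K ϖ ≠ 0 := (Valuation.ne_zero_iff _).2 hϖ.ne_zero
  -- `|ϖ| ≤ exp(−1)`
  have hvϖ : Valued.v ϖ ≤ WithZero.exp (-1 : ℤ) := by
    have hlt : Valued.v ϖ < 1 := (v_lt_one_iff_valuation_lt_one ϖ).2 hϖ.valuation_lt_one
    have hne : Valued.v ϖ ≠ 0 := (Valuation.ne_zero_iff _).2 hϖ.ne_zero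
    obtain ⟨m, hm⟩ : ∃ m : ℤ, Valued.v ϖ = WithZero.exp m := ⟨_, (WithZero.exp_log hne).symm⟩
    rw [hm, ← WithZero.exp_zero, WithZero.exp_lt_exp] at hlt
    rw [hm, WithZero.exp_le_exp]
    omega
  -- `valuation x ≤ (valuation ϖ)⁻¹ ⟺ valuation (x ϖ) ≤ 1 ⟺ |x ϖ| ≤ 1`
  rw [← one_mul (valuation K ϖ)⁻¹, le_mul_inv_iff₀ (zero_lt_iff.2 hϖ0), ← map_mul, ← v_le_one_iff_valuation_le_one, map_mul]
  calc Valued.v x * Valued.v ϖ ≤ WithZero.exp (1 : ℤ) * WithZero.exp (-1 : ℤ) := mul_le_mul' hx hvϖ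
    _ = 1 := by rw [← WithZero.exp_add]; norm_num

omit [ValuativeRel K] [(Valued.v : Valuation K ℤᵐ⁰).Compatible] in
/-- `|y|^e ≤ 1` with `e ≠ 0` forces `|y| ≤ 1` (values in `ℤᵐ⁰`). [folklore] -/
theorem v_le_one_of_pow_le_one {y : K} {e : ℕ} (he : e ≠ 0) (h : Valued.v y ^ e ≤ 1) : Valued.v y ≤ 1 :=
  le_of_not_gt fun hlt => absurd h (not_le.2 (one_lt_pow₀ hlt he))

end Generic

/-! ## §1′ STEP 1 on a completion `K_v` of a number field: some multiple `ψ(g·)` has conductor exactly `𝒪_v`, in `Valued` currency -/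

section NumberField

variable (K : Type) [Field K] [NumberField K] (v : HeightOneSpectrum (𝓞 K))

/-- **LEVEL NORMALISATION, `Valued` READING**: for a continuous non-trivial `ψ` on `K_v` there is `g ∈ K_v` with `ψ(g f) = 1` whenever `|f| ≤ 1` and `ψ(g z) ≠ 1` for some `z` with `|z| ≤ exp 1`
(★ `AddCharDuality.exists_mulShift_level_one` — level one: trivial on `𝓂`, not on `𝒪` — followed by one shift by a uniformiser `π`, `g := tπ`, `z := π⁻¹y₀`).
[cite: BushnellHenniart2006, §1.7] [cite: WeilBNT1967, Ch. II §5 Prop. 12] -/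
theorem exists_mul_conductor_integers {ψ : AddChar (v.adicCompletion K) Circle} (hψ : ψ.IsContinuousNontrivial) :
    ∃ g : v.adicCompletion K, (∀ f : v.adicCompletion K, Valued.v f ≤ 1 → ψ (g * f) = 1) ∧
      ∃ z : v.adicCompletion K, Valued.v z ≤ WithZero.exp (1 : ℤ) ∧ ψ (g * z) ≠ 1 := by
  -- a uniformiser `π` with `|π| = exp(−1)`, irreducible in `𝒪`
  obtain ⟨π₀, hπ₀⟩ := v.valuation_exists_uniformizer K
  set π : v.adicCompletion K := (π₀ : v.adicCompletion K) with hπdef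
  have hπ : Valued.v π = WithZero.exp (-1 : ℤ) := by rw [hπdef, HeightOneSpectrum.valuedAdicCompletion_eq_valuation', hπ₀]
  have hϖ : IsUniformizingElement π := isUniformizingElement_of_v_eq hπ
  have hirr : Irreducible (⟨π, hϖ.mem⟩ : 𝒪[v.adicCompletion K]) := (IsDiscreteValuationRing.irreducible_iff_uniformizer _).mpr hϖ.span_eq
  have hπ0 : π ≠ 0 := hϖ.ne_zero
  obtain ⟨t, -, h𝓂, y₀, hy₀⟩ := AddCharDuality.exists_mulShift_level_one hirr hψ
  refine ⟨t * π, fun f hf => ?_, ⟨π⁻¹ * y₀, ?_, ?_⟩⟩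
  · -- `f ∈ 𝒪 ⇒ πf ∈ 𝓂 ⇒ ψ(t(πf)) = 1`
    have hfO : f ∈ 𝒪[v.adicCompletion K] := (v_le_one_iff_mem_integer f).1 hf
    have hmem : (⟨π, hϖ.mem⟩ * ⟨f, hfO⟩ : 𝒪[v.adicCompletion K]) ∈ 𝓂[v.adicCompletion K] := by
      rw [hϖ.span_eq]
      exact Ideal.mul_mem_right _ _ (Ideal.mem_span_singleton_self _)
    have h1 := h𝓂 _ hmem
    rw [AddChar.mulShift_apply, Subring.coe_mul] at h1
    rw [mul_assoc]
    exact h1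
  · -- `|π⁻¹ y₀| = exp 1 · |y₀| ≤ exp 1`
    have hy₀v : Valued.v (y₀ : v.adicCompletion K) ≤ 1 := (v_le_one_iff_mem_integer _).2 y₀.2
    rw [map_mul, map_inv₀, hπ, WithZero.exp_neg, inv_inv]
    exact mul_le_of_le_one_right zero_le hy₀v
  · -- `ψ(tπ · π⁻¹y₀) = ψ(t y₀) ≠ 1`
    rw [mul_assoc, mul_inv_cancel_left₀ hπ0, ← AddChar.mulShift_apply]
    exact hy₀

end NumberField

/-! ## §2 The CM place `w ∣ v`: base character through `ι = toPlace v w`, the two halves, the dichotomy, the dealt bytes -/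

section CM

variable (L : Type) [Field L] [NumberField L] [IsCMField L] (v : HeightOneSpectrum (𝓞 ↥(maximalRealSubfield L)))
  (w : UnitaryGroup.PlacesOver L v) (hw : IsCMField.complexConj L • w.1 = w.1)

omit [IsCMField L] in
/-- **STEP 1 AT THE CM PLACE — A CONTINUOUS CHARACTER `ψ₃` OF `L_w` WHOSE RESTRICTION ALONG `ι = toPlace v w` HAS CONDUCTOR EXACTLY `𝒪_v`**: `ψ₃(ι f) = 1` for `|f|_v ≤ 1` and
`ψ₃(ι z) ≠ 1` for some `z ∈ L⁺_v` with `|z|_v ≤ exp 1`.  (`ψ₃ := ψ_w(x₁ · ι g ·)` with Tate's `ψ_w` ★ `adeleAddCharAt L w.1`, `ψ_w x₁ ≠ 1`, and `g` from `exists_mul_conductor_integers` applied to the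
continuous non-trivial pull-back `f ↦ ψ_w(x₁ ι f)`.) [cite: CasselsFrohlichANT1967, Ch. XV (Tate), Lemma 2.2.3] [cite: BushnellHenniart2006, §1.7] -/
theorem exists_addChar_toPlace_conductor_integers :
    ∃ ψ₃ : AddChar (w.1.adicCompletion L) Circle, Continuous ψ₃ ∧
      (∀ f : v.adicCompletion ↥(maximalRealSubfield L), Valued.v f ≤ 1 → ψ₃ (toPlace v w f) = 1) ∧
      ∃ z : v.adicCompletion ↥(maximalRealSubfield L), Valued.v z ≤ WithZero.exp (1 : ℤ) ∧ ψ₃ (toPlace v w z) ≠ 1 := by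
  set ψw := adeleAddCharAt L w.1 with hψw
  have hcont : Continuous ψw := (isContinuousNontrivial_adeleAddCharAt L w.1).1
  obtain ⟨x₁, hx₁⟩ := AddChar.ne_zero_iff.1 (isContinuousNontrivial_adeleAddCharAt L w.1).2
  -- `ψ₂ := ψ_w(x₁ ·)` and its pull-back `ψ_F` along `ι`
  set ψ₂ := ψw.mulShift x₁ with hψ₂
  have hψ₂c : Continuous ψ₂ := continuous_mulShift hcont x₁
  set ψF : AddChar (v.adicCompletion ↥(maximalRealSubfield L)) Circle := ψ₂.compAddMonoidHom (toPlace v w).toAddMonoidHom with hψF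
  have hψF_apply : ∀ f, ψF f = ψ₂ (toPlace v w f) := fun f => rfl
  have hψFc : Continuous ψF := by
    have h : (⇑ψF : v.adicCompletion ↥(maximalRealSubfield L) → Circle) = fun f => ψ₂ (toPlace v w f) := funext hψF_apply
    rw [h]
    exact hψ₂c.comp (continuous_toPlace v w)
  have hψF0 : ψF ≠ 0 := by
    intro h0
    have h1 : ψF 1 = 1 := by rw [h0, AddChar.zero_apply]
    rw [hψF_apply, map_one, hψ₂, AddChar.mulShift_apply, mul_one] at h1
    exact hx₁ h1
  obtain ⟨g, hg, z, hz, hgz⟩ := exists_mul_conductor_integers ↥(maximalRealSubfield L) v (ψ := ψF) ⟨hψFc, hψF0⟩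
  refine ⟨ψ₂.mulShift (toPlace v w g), continuous_mulShift hψ₂c _, fun f hf => ?_, ⟨z, hz, ?_⟩⟩
  · rw [AddChar.mulShift_apply, ← map_mul, ← hψF_apply]
    exact hg f hf
  · rw [AddChar.mulShift_apply, ← map_mul, ← hψF_apply]
    exact hgz

omit [IsCMField L] in
/-- The fixed line has valuation controlled by `L⁺_v`: if `|ι f|_w ≤ 1` then `|f|_v ≤ 1` (`|ι f| = |f|^{e(w|v)}`, `e ≠ 0` at a place above `v`). [cite: Serre1979, Ch. III §3] -/
theorem v_le_one_of_v_toPlace_le_one {f : v.adicCompletion ↥(maximalRealSubfield L)} (he0 : v.asIdeal.ramificationIdx' w.1.asIdeal ≠ 0)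
    (h : Valued.v (toPlace v w f) ≤ 1) : Valued.v f ≤ 1 := by
  rw [valued_toPlace] at h
  exact v_le_one_of_pow_le_one he0 h

include hw in
/-- **THE RAMIFIED HALF (`ε = +1`)**: at a non-split place `w ∣ v` with `e(w|v) ≠ 1` and for any uniformizing `ϖ` of `L_w`, there is a CONTINUOUS `ψ : AddChar L_w Circle` of conductor exactly `𝒪_w`
(`ψ x = 1` for `valuation x ≤ 1`; `ψ x ≠ 1` for some `x` with `valuation x ≤ (valuation ϖ)⁻¹`) which is TRIVIAL ON THE FIXED FIELD of `σ_w` (`σ a = a → ψ a = 1`): `ψ(x) = ψ₃(c x + σ(c x))` with `c = (στ − τ)⁻¹`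
skew of valuation `exp d`, `d` the different exponent (★ `exists_different_traceDual_of_ramified`: inverse different and sharp trace preimages).
[cite: Serre1979, Ch. III §3 Prop. 7, §6 Cor. 2] [cite: WeilBNT1967, Ch. VIII §1] -/
theorem exists_addChar_conductor_integers_anti_of_ramified (he : v.asIdeal.ramificationIdx' w.1.asIdeal ≠ 1) {ϖ : w.1.adicCompletion L} (hϖ : IsUniformizingElement ϖ) :
    ∃ ψ : AddChar (w.1.adicCompletion L) Circle, Continuous ψ ∧
      (∀ x : w.1.adicCompletion L, valuation (w.1.adicCompletion L) x ≤ 1 → ψ x = 1) ∧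
      (∃ x : w.1.adicCompletion L, valuation (w.1.adicCompletion L) x ≤ (valuation (w.1.adicCompletion L) ϖ)⁻¹ ∧ ψ x ≠ 1) ∧
      (∀ a : w.1.adicCompletion L, galAdicCompletionMap (L := L) (IsCMField.complexConj L) hw a = 1 * a → ψ a = 1) := by
  haveI : Algebra.IsQuadraticExtension ↥(maximalRealSubfield L) L := IsCMField.isQuadraticExtension L
  have hc1 : IsCMField.complexConj L ≠ 1 := IsCMField.complexConj_ne_one L
  set σ := galAdicCompletionMap (L := L) (IsCMField.complexConj L) hw with hσdef
  -- STEP 1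
  obtain ⟨ψ₃, hψ₃c, hE1, z, hz, hE2⟩ := exists_addChar_toPlace_conductor_integers L v w
  -- the different package at the ramified place
  obtain ⟨d, -, hR1, -, hR3, hR4⟩ := exists_different_traceDual_of_ramified L v w hw he
  -- a uniformiser `τ` of `L_w` and the skew element `s = στ − τ` of valuation `exp(−d)`
  obtain ⟨π₀, hπ₀⟩ := w.1.valuation_exists_uniformizer L
  set τ : w.1.adicCompletion L := (π₀ : w.1.adicCompletion L) with hτdef
  have hτ : Valued.v τ = WithZero.exp (-1 : ℤ) := by rw [hτdef, HeightOneSpectrum.valuedAdicCompletion_eq_valuation', hπ₀]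
  set s : w.1.adicCompletion L := σ τ - τ with hsdef
  have hs : Valued.v s = WithZero.exp (-(d : ℤ)) := hR1 τ hτ
  have hs0 : s ≠ 0 := fun h0 => by rw [h0, map_zero] at hs; exact WithZero.coe_ne_zero.symm hs
  have hσs : σ s = -s := by
    rw [hsdef, map_sub, galAdicCompletionMap_galAdicCompletionMap_of_smul_eq (IsCMField.complexConj L) w hc1 hw τ]
    ring
  set c : w.1.adicCompletion L := s⁻¹ with hcdef
  have hσc : σ c = -(1 * c) := by rw [hcdef, map_inv₀, hσs, one_mul, ← neg_inv]
  have hvc : Valued.v c = WithZero.exp (d : ℤ) := by rw [hcdef, map_inv₀, hs, WithZero.exp_neg, inv_inv]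
  -- the sharp trace preimage of `ι z`
  obtain ⟨y, hy1, hy2⟩ := hR3 z
  -- the twisted character
  obtain ⟨Ψ, hΨ, hkill⟩ := exists_addChar_twist σ ψ₃ c
  refine ⟨Ψ, continuous_twist (continuous_galAdicCompletionMap L (IsCMField.complexConj L) hw) hψ₃c c hΨ, fun x hx => ?_, ⟨y * s, ?_, ?_⟩, hkill 1 (one_mul 1) hσc⟩
  · -- (hψ): `|x| ≤ 1 ⇒ |cx + σ(cx)| ≤ 1` (inverse different) `⇒ cx + σ(cx) = ι f`, `|f| ≤ 1 ⇒ ψ₃(ι f) = 1`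
    have hvx : Valued.v x ≤ 1 := (v_le_one_iff_valuation_le_one x).2 hx
    have h1 : Valued.v (x * c + σ (x * c)) ≤ 1 := (hR4 c).2 hvc.le x hvx
    obtain ⟨f, hf⟩ := exists_toPlace_eq_add_galAdicCompletionMap L v w hw (c * x)
    have hfv : Valued.v f ≤ 1 := by
      refine v_le_one_of_v_toPlace_le_one L v w (by rw [Liu2021.LemD1IndexedNonVacuityRamifiedPlace.ramificationIdx'_eq_two_of_ne_one L v (IsCMField.complexConj L) hc1 w hw he]; norm_num) ?_
      rw [hf, mul_comm c x]
      exact h1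
    rw [hΨ, ← hf]
    exact hE1 f hfv
  · -- (hψ'), valuation: `x := y·s` with `y + σy = ι z`, `|y|·exp(1 − d) = |ι z| = |z|² ≤ exp 2` ⇒ `|x| ≤ exp 1`
    refine valuation_le_inv_of_v_le_exp_one hϖ ?_
    have hιz : Valued.v (toPlace v w z) ≤ WithZero.exp (2 : ℤ) := by
      rw [valued_toPlace_eq_sq_of_ramified L v w hw he z]
      calc Valued.v z ^ 2 ≤ WithZero.exp (1 : ℤ) ^ 2 := pow_le_pow_left' hz 2
        _ = WithZero.exp (2 : ℤ) := by rw [pow_two, ← WithZero.exp_add]; norm_num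
    have h2 : Valued.v (y * s) = Valued.v y * WithZero.exp (1 - (d : ℤ)) * WithZero.exp (-1 : ℤ) := by
      rw [map_mul, hs, mul_assoc, ← WithZero.exp_add]
      congr 2
      ring
    rw [h2, hy2]
    calc Valued.v (toPlace v w z) * WithZero.exp (-1 : ℤ) ≤ WithZero.exp (2 : ℤ) * WithZero.exp (-1 : ℤ) := mul_le_mul' hιz le_rfl
      _ = WithZero.exp (1 : ℤ) := by rw [← WithZero.exp_add]; norm_num
  · -- (hψ'), value: `c·(y s) = y`, so `Ψ(y s) = ψ₃(y + σy) = ψ₃(ι z) ≠ 1`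
    have hcy : c * (y * s) = y := by rw [hcdef, mul_comm y s, ← mul_assoc, inv_mul_cancel₀ hs0, one_mul]
    rw [hΨ, hcy, hy1]
    exact hE2

omit [IsCMField L] in
/-- `e(w|v) = 1` when `v` is unramified in `L` (Mathlib `IsUnramifiedIn.ramificationIdx_eq_one` at the prime `w ∣ v`). [folklore] -/
theorem ramificationIdx'_eq_one_of_isUnramifiedIn (hunr : Algebra.IsUnramifiedIn (𝓞 L) v.asIdeal) : v.asIdeal.ramificationIdx' w.1.asIdeal = 1 := by
  haveI := UnitaryGroup.PlacesOver.liesOver (E := L) w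
  rw [Ideal.ramificationIdx'_eq_ramificationIdx v.asIdeal w.1.asIdeal v.ne_bot]
  exact hunr.ramificationIdx_eq_one (UnitaryGroup.PlacesOver.liesOver (E := L) w)

include hw in
/-- **THE INERT-UNRAMIFIED HALF (`ε = −1`)**: at a non-split place `w ∣ v` with `v` unramified in `L`, for any uniformizing `ϖ` of `L_w`, there is a CONTINUOUS `ψ : AddChar L_w Circle` of conductor
exactly `𝒪_w` which is TRIVIAL ON THE SKEW LINE of `σ_w` (`σ a = −a → ψ a = 1`): `ψ(x) = ψ₃(x + σx)`; triviality on `𝒪_w` by `|x + σx| ≤ |x|` (★ `σ_w` isometric), non-triviality at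
`x = ι(z t₀⁻¹)·ω` for ★ a unit `ω` of unit trace `ι t₀` (unramified trace is onto). [cite: Serre1979, Ch. V §2] [cite: WeilBNT1967, Ch. VIII §1] -/
theorem exists_addChar_conductor_integers_anti_of_isUnramifiedIn (hunr : Algebra.IsUnramifiedIn (𝓞 L) v.asIdeal) {ϖ : w.1.adicCompletion L} (hϖ : IsUniformizingElement ϖ) :
    ∃ ψ : AddChar (w.1.adicCompletion L) Circle, Continuous ψ ∧
      (∀ x : w.1.adicCompletion L, valuation (w.1.adicCompletion L) x ≤ 1 → ψ x = 1) ∧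
      (∃ x : w.1.adicCompletion L, valuation (w.1.adicCompletion L) x ≤ (valuation (w.1.adicCompletion L) ϖ)⁻¹ ∧ ψ x ≠ 1) ∧
      (∀ a : w.1.adicCompletion L, galAdicCompletionMap (L := L) (IsCMField.complexConj L) hw a = -1 * a → ψ a = 1) := by
  set σ := galAdicCompletionMap (L := L) (IsCMField.complexConj L) hw with hσdef
  -- STEP 1
  obtain ⟨ψ₃, hψ₃c, hE1, z, hz, hE2⟩ := exists_addChar_toPlace_conductor_integers L v w
  -- `e = 1`: `|ι f| = |f|`
  have he1 := ramificationIdx'_eq_one_of_isUnramifiedIn L v w hunr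
  have hι : ∀ f : v.adicCompletion ↥(maximalRealSubfield L), Valued.v (toPlace v w f) = Valued.v f := fun f => by rw [valued_toPlace, he1, pow_one]
  -- the unit of unit trace
  obtain ⟨ω, hω, hωtr⟩ := Literature.NumberTheory.LocalFields.UnramifiedQuadraticNorm.exists_v_eq_one_v_add_galAdicCompletionMap_eq_one L v w hw hunr
  obtain ⟨t₀, ht₀⟩ := exists_toPlace_eq_add_galAdicCompletionMap L v w hw ω
  have ht₀v : Valued.v t₀ = 1 := by rw [← hι, ht₀]; exact hωtr
  have ht₀0 : t₀ ≠ 0 := fun h0 => by rw [h0, map_zero] at ht₀v; exact zero_ne_one ht₀v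
  -- the twist with `c = 1`
  have hσ1 : σ 1 = -((-1 : w.1.adicCompletion L) * 1) := by rw [map_one]; ring
  obtain ⟨Ψ, hΨ, hkill⟩ := exists_addChar_twist σ ψ₃ 1
  refine ⟨Ψ, continuous_twist (continuous_galAdicCompletionMap L (IsCMField.complexConj L) hw) hψ₃c 1 hΨ, fun x hx => ?_,
    ⟨toPlace v w (z * t₀⁻¹) * ω, valuation_le_inv_of_v_le_exp_one hϖ ?_, ?_⟩, hkill (-1) (by ring) hσ1⟩
  · -- (hψ): `|x + σx| ≤ |x| ≤ 1`, `x + σx = ι f`, `|f| ≤ 1`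
    have hvx : Valued.v x ≤ 1 := (v_le_one_iff_valuation_le_one x).2 hx
    have h1 : Valued.v (1 * x + σ (1 * x)) ≤ 1 := by
      rw [one_mul]
      refine (Valuation.map_add _ _ _).trans (max_le hvx ?_)
      rw [hσdef, valued_galAdicCompletionMap]
      exact hvx
    obtain ⟨f, hf⟩ := exists_toPlace_eq_add_galAdicCompletionMap L v w hw (1 * x)
    have hfv : Valued.v f ≤ 1 := by rw [← hι, hf]; exact h1
    rw [hΨ, ← hf]
    exact hE1 f hfv
  · -- (hψ'), valuation: `|ι(z t₀⁻¹)·ω| = |z| ≤ exp 1`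
    rw [map_mul, hι, map_mul, map_inv₀, ht₀v, inv_one, mul_one, hω, mul_one]
    exact hz
  · -- (hψ'), value: `x + σx = ι(z t₀⁻¹)·(ω + σω) = ι z`
    have hsum : 1 * (toPlace v w (z * t₀⁻¹) * ω) + σ (1 * (toPlace v w (z * t₀⁻¹) * ω)) = toPlace v w z := by
      rw [one_mul, map_mul σ (toPlace v w (z * t₀⁻¹)) ω, hσdef, galAdicCompletionMap_toPlace (IsCMField.complexConj L) w w hw, ← mul_add, ← ht₀, ← map_mul,
        inv_mul_cancel_right₀ ht₀0]
    rw [hΨ, hsum]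
    exact hE2

include hw in
/-- At a non-split `w ∣ v` that is NOT unramified, `e(w|v) ≠ 1` (`w` is the only prime above `v`, ★ `PlacesOver.eq_of_smul_eq`; Mathlib `Ideal.ramificationIdx_eq_one_iff`) — local copy of the bridge of
★ `K2E3LocalLatticeScalingIndex` ∕ ★ `RankOneUnstableRamifiedUnitSimilitude`. [cite: Serre1979, Ch. III §6] -/
theorem ramificationIdx'_ne_one_of_not_isUnramifiedIn (hram : ¬ Algebra.IsUnramifiedIn (𝓞 L) v.asIdeal) : v.asIdeal.ramificationIdx' w.1.asIdeal ≠ 1 := by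
  haveI : Algebra.IsQuadraticExtension ↥(maximalRealSubfield L) L := IsCMField.isQuadraticExtension L
  have hc1 : IsCMField.complexConj L ≠ 1 := IsCMField.complexConj_ne_one L
  intro he
  apply hram
  intro P hP hPover
  have hP0 : P ≠ ⊥ := Ideal.ne_bot_of_liesOver_of_ne_bot v.ne_bot P
  have hPw : P = w.1.asIdeal :=
    congrArg (fun u : UnitaryGroup.PlacesOver L v => u.1.asIdeal)
      (UnitaryGroup.PlacesOver.eq_of_smul_eq (IsCMField.complexConj L) hc1 w hw ⟨⟨P, hP, hP0⟩, HeightOneSpectrum.ext hPover.over.symm⟩)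
  subst hPw
  haveI : v.asIdeal.IsMaximal := v.isMaximal
  rw [← Ideal.ramificationIdx_eq_one_iff, ← Ideal.ramificationIdx'_eq_ramificationIdx v.asIdeal w.1.asIdeal v.ne_bot]
  exact he

include hw in
/-- **(Psi-twisted) — THE DEALT BYTES**: at every NON-SPLIT place `w ∣ v` of the CM extension and for every uniformizing `ϖ` of `L_w`,
`∃ (ε : L_w) (ψ : AddChar L_w Circle), (ε = 1 ∨ ε = −1) ∧ (∀ x, valuation _ x ≤ 1 → ψ x = 1) ∧ (∃ x, valuation _ x ≤ (valuation _ ϖ)⁻¹ ∧ ψ x ≠ 1) ∧ (∀ a, σ_w a = ε * a → ψ a = 1)` —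
the `hψ` ∕ `hψ'` ∕ `hanti` letters of ★ p855984 (Char-U) and of the non-split parameter package; `ε = 1` at ramified places, `ε = −1` at inert ones.
[cite: Serre1979, Ch. III §3 Prop. 7, Ch. V §2] [cite: WeilBNT1967, Ch. II §5 Prop. 12, Ch. VIII §1] [cite: BushnellHenniart2006, §1.7] [cite: CasselsFrohlichANT1967, Ch. XV (Tate), Lemma 2.2.3] -/
theorem exists_sign_addChar_conductor_integers_anti {ϖ : w.1.adicCompletion L} (hϖ : IsUniformizingElement ϖ) :
    ∃ (ε : w.1.adicCompletion L) (ψ : AddChar (w.1.adicCompletion L) Circle), (ε = 1 ∨ ε = -1) ∧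
      (∀ x : w.1.adicCompletion L, valuation (w.1.adicCompletion L) x ≤ 1 → ψ x = 1) ∧
      (∃ x : w.1.adicCompletion L, valuation (w.1.adicCompletion L) x ≤ (valuation (w.1.adicCompletion L) ϖ)⁻¹ ∧ ψ x ≠ 1) ∧
      (∀ a : w.1.adicCompletion L, galAdicCompletionMap (L := L) (IsCMField.complexConj L) hw a = ε * a → ψ a = 1) := by
  by_cases hunr : Algebra.IsUnramifiedIn (𝓞 L) v.asIdeal
  · obtain ⟨ψ, -, h1, h2, h3⟩ := exists_addChar_conductor_integers_anti_of_isUnramifiedIn L v w hw hunr hϖ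
    exact ⟨-1, ψ, Or.inr rfl, h1, h2, h3⟩
  · obtain ⟨ψ, -, h1, h2, h3⟩ := exists_addChar_conductor_integers_anti_of_ramified L v w hw (ramificationIdx'_ne_one_of_not_isUnramifiedIn L v w hw hunr) hϖ
    exact ⟨1, ψ, Or.inl rfl, h1, h2, h3⟩

end CM

end Summit.HodgeConjecture.HodgeConjecture.Cruxes.H413.K2E3LocalAdditiveCharacterTwisted

end
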